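import Summits.BirchSwinnertonDyer.Rank1Residual.P2.Conjectures.CongruentNumberSilentEvenFiveAtTwo
import Literature.NumberTheory.EllipticCurves.MordellWeilTheoremProofs
import HarnessLib
import HarnessLib.Audit.Tags

/-!
# Cell «bsd-monsky» (typer): the ODD-INDEX HEEGNER DATUM on `𝒮⁻` in tree currency, and the GLUE
# `datum + Monsky 1990 Cor 5.15 ⟹ C-P2-1` through the landed door D-CN-5 — nothing asserted

HONEST FRAMING (cell `bsd-monsky`, run/shared/lean/pub/bsd-monsky/, README §1: ONE theorem on ONE
explicit infinite family of quadratic twists of `y² = x³ − x` at the prime `2`; nothing is booked until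
a cross-family referee passes the written proof against the PRINTED sources). This file asserts NO
arithmetic fact: it fixes, in the tree's currency, the EXACT output that the Monsky route (README §2,
desk route T15 «transplant, not transport») must deliver on the family
`𝒮⁻ = {2pq : p ≡ 5 (mod 8), q ≡ 3 (mod 4) primes, (p/q) = −1}`, and PROVES that this output, together
with Monsky 1990 Cor 5.15 (`h515`, the displayed fact already consumed by the `𝒮⁺` theorem), closes
the candidate law C-P2-1 of `P2/Conjectures/CongruentNumberSilentEvenFiveAtTwo.lean` in BOTH its forms.
Every theorem below takes the datum as an explicit HYPOTHESIS (`hmech`); the datum is a Summits-side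
`def … : Prop` of this lane, NEVER a Literature fact (it is equivalent, modulo rank one, to the crux
itself — §3 proves this equivalence so that nobody mistakes it for an input).

## The mechanism (README §1–§2; second reads `p2/lit/L2-38-RT15c-SECOND-READ-lit2.md`, `…/L2-41-…`)

For `N = 2pq ∈ 𝒮⁻` (both `q ≡ 3 (mod 8)` = Monsky's case (13) and `q ≡ 7 (mod 8)` = the
`(p₅/p₇) = −1` half of case (15)), with `K = ℚ(√−N)`, `𝒜 = Cl(K)` and Tian's CM points
`z_t ∈ E(H(i))` (`E : y² = x³ − x`; Tian 2014 Def. 2.7, Thm. 2.8):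
* **M-y** (Monsky 1990 Thm. 5.5 / Thm. 5.9 (1) + Thm. 4.7, transplanted onto Tian's points through the
  dictionary Tian Thm. 2.8 (1)–(3) ↔ Monsky Thm. 2.11 (1)–(3); second read L2-38 §2, FOLLOWS on
  (13) and (15)⁻): the half-system sum `y_N := Σ_{t ∈ φ} z_t` (Tian (4.5), `φ` representatives of
  `𝒜/[ϖ′]`) lies in `E(K)⁻ ≅ E_N(ℚ)` and `y_N ∉ 2E(K)⁻ + E[2]`.
* **GZ** (Tian–Yuan–Zhang 2017 Thm. 3.3 at `(d₀, d₁) = (N, 1)` together with Tian 2014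
  `P_{χ₀}(f) = 4y_N` (p0027 L62–L64) and the assembly (B4) of L2-38 §0): `y_N ≐ ±𝓛(N)·g` modulo
  torsion, `g` a generator of `E_N(ℚ)/E_N(ℚ)_tor`, `𝓛(N)` the integer of TYZ Thm. 1.2.
* rank `E_N(ℚ) = 1` and `Ш(E_N)[2^∞] = 0` (Monsky Cor. 5.15 (2′), `h515`).
Hence `𝓛(N)` is ODD, `ord_{s=1} L(E_N, s) = 1` and `BSD(E_N, 2)` — C-P2-1. The datum
`OddIndexHeegnerDatum N` (§1) is the conjunction «M-y ∧ GZ» with the point `y_N` existentially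
quantified (the tree has no name for Tian's CM points); §2 is the group theory «M-y ∧ GZ ∧ rank 1 ⟹
`𝓛(N)` odd» and the passage through D-CN-5; §3 the converse bookkeeping.

References: [Monsky1990MockHeegner] Thm. 2.11 (p. 51), Def. 4.4 and Remark (pp. 56–57), Thms. 4.5, 4.7
(pp. 57–58), Lemma 5.4, Thm. 5.5 (p. 62), Lemma 5.8, Thm. 5.9 (1) (pp. 63–64), Thm. 5.14 (13)/(15)
(p. 66), Cor. 5.15 (2′) (p. 66), Remark (2) (p. 67); [Tian2014] Prop. 2.1 (arXiv:1210.8231 p. 6), Def. 2.7,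
Thm. 2.8 (p. 11), (4.5), (4.8) (pp. 22–23), p. 27 L62–L64; [TianYuanZhang2017] Thm. 1.2, Thm. 3.3;
[Miller2011LMS] Def. 1.1; HOME `run/shared/lean/pub/bsd-monsky/lean/PLAN.md` (the enclosure plan of
which this file is tier 0).
-/

noncomputable section

open scoped Classical

open WeierstrassCurve Literature.NumberTheory.EllipticCurves
  Literature.NumberTheory.EllipticCurves.Rank1Residual
  Literature.NumberTheory.EllipticCurves.Rank1Residual.Typed
  Literature.NumberTheory.EllipticCurves.Monsky1990
  Literature.NumberTheory.EllipticCurves.TianYuanZhang2017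

set_option autoImplicit false

namespace Summit.BirchSwinnertonDyer.Rank1Residual.P2

open Conjectures

/-! TECHNICAL (tree idiom of `P2/CongruentNumberPairsAtTwoHalvingBitsDoor.lean`): statements about points
of `E_N(ℚ)` carry an arbitrary `[DecidableEq ℚ]` instance (Mathlib's group law on `W.toAffine.Point` is
parametrised by it); inside the proofs it is normalised to the classical instance baked into the generic
Mordell–Weil lemmas (`mordellWeilModTorsion`, `exists_isMordellWeilBasis_holds`). -/

section Datum

variable [inst : DecidableEq ℚ]

/-! ## §1 The datum (a `Prop` on `N`; nothing asserted) -/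

/-- "`g` generates the free part of `E_N(ℚ)`": every rational point of `E_N : y² = x³ − N²x` is an
integer multiple of `g` up to a torsion point (the tree-side twin of TYZ's `GeneratesFreePart` for
`A(K_n)⁻`, read on `E_N(ℚ) ≅ E(ℚ(√−N))⁻`). A predicate; nothing asserted.
[cite: TianYuanZhang2017, §3.1 (chunk p0011 L29–L36)] -/
def GeneratesFreePartRat (N : ℕ) (g : (congruentNumberCurve N).toAffine.Point) : Prop :=
  ∀ z : (congruentNumberCurve N).toAffine.Point, ∃ m : ℤ, IsOfFinAddOrder (z - m • g)

/-- **The ODD-INDEX HEEGNER DATUM at `N`** — the output of the Monsky route in tree currency: a point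
`y ∈ E_N(ℚ)` (Tian's `y_N = Σ_{t ∈ φ} z_t`, read on `E_N(ℚ) ≅ E(ℚ(√−N))⁻`) and an integer `L` with
`L² = 𝓛(N)²` (`IsScriptL N L`, TYZ Thm. 1.2) such that
(GZ) for every generator `g` of the free part of `E_N(ℚ)`, `y − (±L)·g` is torsion — the explicit
Gross–Zagier relation `y_N ≐ ±𝓛(N)·g` (TYZ Thm. 3.3 at `(N, 1)` + Tian `P_{χ₀}(f) = 4y_N` + (B4));
(M-y) `y ∉ 2E_N(ℚ) + E_N(ℚ)_tor` — Monsky 1990 Thm. 5.5 / Thm. 5.9 (1) transplanted onto Tian's points.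
A `Prop`; NOT a Literature fact (§3: modulo rank one it is equivalent to "`𝓛(N)` is odd", i.e. to the
crux); the HYPOTHESIS of the glue theorems of §2.
[cite: Monsky1990MockHeegner, Thm. 5.14 (13)/(15) (p. 66), Thm. 5.5 (p. 62), Thm. 5.9 (1) (pp. 63–64)]
[cite: Tian2014, Thm. 2.8 (arXiv:1210.8231 p. 11), (4.5) (p. 22), p. 27 L62–L64]
[cite: TianYuanZhang2017, Thm. 1.2, Thm. 3.3] -/
@[conjecture] def OddIndexHeegnerDatum (N : ℕ) : Prop :=
  ∃ (y : (congruentNumberCurve N).toAffine.Point) (L : ℤ), IsScriptL N L ∧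
    (∀ g : (congruentNumberCurve N).toAffine.Point, GeneratesFreePartRat N g →
      ∃ s : ℤ, (s = 1 ∨ s = -1) ∧ IsOfFinAddOrder (y - (s * L) • g)) ∧
    (∀ z t : (congruentNumberCurve N).toAffine.Point, IsOfFinAddOrder t → y ≠ (2 : ℤ) • z + t)

/-! ## §2 Glue: rank one ⟹ a generator exists; datum ⟹ `𝓛(N)` odd ⟹ C-P2-1 (through D-CN-5) -/

/-- **Rank one gives a generator of the free part** (Mordell–Weil basis of length `1`,
`exists_isMordellWeilBasis_holds`, proved in the tree): if `rank E_N(ℚ) = 1` there is `g` with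
`GeneratesFreePartRat N g` whose class `ḡ` in `E_N(ℚ)/tor` is non-zero.
[cite: SilvermanAEC2009, Thm. VIII.6.7] -/
theorem exists_generatesFreePartRat_of_mordellWeilRank_eq_one {N : ℕ} (hN0 : N ≠ 0)
    (hrank : (congruentNumberCurve N).mordellWeilRank = 1) :
    ∃ g : (congruentNumberCurve N).toAffine.Point, GeneratesFreePartRat N g ∧
      ¬ IsOfFinAddOrder g := by
  have e : inst = fun a b => Classical.propDecidable (a = b) := Subsingleton.elim _ _
  subst e
  letI : DecidableEq ℚ := fun a b => Classical.propDecidable (a = b)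
  haveI := isElliptic_congruentNumberCurve hN0
  obtain ⟨P, hli, hspan⟩ := (congruentNumberCurve N).exists_isMordellWeilBasis_holds
  have h0 : 0 < (congruentNumberCurve N).mordellWeilRank := by rw [hrank]; exact one_pos
  refine ⟨P ⟨0, h0⟩, fun z => ?_, fun hg => ?_⟩
  · have hmem : (QuotientAddGroup.mk z : mordellWeilModTorsion (congruentNumberCurve N)) ∈
        Submodule.span ℤ (Set.range (QuotientAddGroup.mk ∘ P :
          Fin (congruentNumberCurve N).mordellWeilRank →
            mordellWeilModTorsion (congruentNumberCurve N))) := by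
      rw [hspan]; trivial
    obtain ⟨c, hc⟩ := (Submodule.mem_span_range_iff_exists_fun ℤ).mp hmem
    rw [Finset.sum_eq_single_of_mem ⟨0, h0⟩ (Finset.mem_univ _)
      (fun i _ hi => absurd (Fin.ext (by have := i.isLt; omega)) hi)] at hc
    refine ⟨c ⟨0, h0⟩, ?_⟩
    rw [← AddCommGroup.mem_torsion, ← QuotientAddGroup.eq_zero_iff, QuotientAddGroup.mk_sub,
      QuotientAddGroup.mk_zsmul, ← hc, Function.comp_apply, sub_self]
  · exact hli.ne_zero ⟨0, h0⟩
      ((QuotientAddGroup.eq_zero_iff _).mpr ((AddCommGroup.mem_torsion _).mpr hg))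

/-- **M-y ∧ GZ ∧ rank one ⟹ `𝓛(N)` odd** (pure group theory in `E_N(ℚ)`): if `L` were even, `L = 2L′`,
the relation `y − (±L)·g ∈ tor` would put `y` in `2E_N(ℚ) + tor`, against (M-y).
[cite: Monsky1990MockHeegner, Lemma 3.3 (3) and the Remark after it (p. 53)] -/
theorem exists_odd_scriptL_of_oddIndexHeegnerDatum {N : ℕ} (hN0 : N ≠ 0)
    (hrank : (congruentNumberCurve N).mordellWeilRank = 1) (h : OddIndexHeegnerDatum N) :
    ∃ L : ℤ, Odd L ∧ IsScriptL N L := by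
  obtain ⟨y, L, hL, hGZ, hnot⟩ := h
  obtain ⟨g, hg, -⟩ := exists_generatesFreePartRat_of_mordellWeilRank_eq_one hN0 hrank
  refine ⟨L, ?_, hL⟩
  by_contra hodd
  obtain ⟨L', hL'⟩ := Int.not_odd_iff_even.mp hodd
  obtain ⟨s, -, ht⟩ := hGZ g hg
  apply hnot ((s * L') • g) (y - (s * L) • g) ht
  have h2 : (2 : ℤ) • ((s * L') • g) = (s * L) • g := by
    rw [← mul_zsmul, hL']; congr 1; ring
  rw [h2]; abel

/-- **C-P2-1, SHARPER (`Ш_an`-unit) FORM, from the datum on `𝒮⁻` and Monsky 1990 Cor 5.15.** For every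
`(p, q)` of `𝒮⁻`: `𝓛(2pq)` odd (§2), `ord_{s=1} L = 1` (`analyticRank_congruentNumberCurve_eq_one_of_isScriptL`:
root number `−1` and `𝓛 ≠ 0`), `L′(E_{2pq}, 1) = 2²·𝓛²·Ω·Reg` (`leadingLCoeff_congruentNumberCurve_eq_of_isScriptL`,
`2k − 2 − a = 2`), so `x = 4𝓛²` has `ord₂ x = 2`. Rank one is `h515`. No GZK binder.
[cite: TianYuanZhang2017, §1 (definition of 𝓛(n) and (1.1), p0002 L46–L75)]
[cite: Monsky1990MockHeegner, Cor. 5.15 (2′) (p. 66), Remark (2) (p. 67)] -/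
theorem congruentSilentEvenFiveOrdTwo_of_oddIndexHeegnerDatum
    (h515 : cor515_rank_eq_one_and_card_selmerGroup_two)
    (hmech : ∀ p q : ℕ, p.Prime → q.Prime → p % 8 = 5 → q % 4 = 3 → jacobiSym p q = -1 →
      OddIndexHeegnerDatum (2 * (p * q))) :
    CongruentSilentEvenFiveOrdTwo := by
  intro p q hp hq hp5 hq4 hj
  obtain ⟨hN, hp2, hq2, hne⟩ := isCor515Family_two_mul_five_mul hp hq hp5 hq4
  have hsq : Squarefree (2 * (p * q)) := hN.squarefree
  haveI := isElliptic_congruentNumberCurve hN.ne_zero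
  have hrank : (congruentNumberCurve (2 * (p * q))).mordellWeilRank = 1 := (h515 _ hN).1
  obtain ⟨L, hLodd, hL⟩ :=
    exists_odd_scriptL_of_oddIndexHeegnerDatum hN.ne_zero hrank (hmech p q hp hq hp5 hq4 hj)
  have hL0' : L ≠ 0 := fun h => by simp [h] at hLodd
  have hL0 : (L : ℚ) ≠ 0 := by exact_mod_cast hL0'
  have hr1 := analyticRank_congruentNumberCurve_eq_one_of_isScriptL hsq hN.mod_eight hL hL0'
  obtain ⟨he, -⟩ := twoExponent_tamagawa_two_mul_prime_mul hp hq hp2 hq2 hne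
  refine ⟨(2 : ℚ) ^ twoExponent (2 * (p * q)) * (L : ℚ) ^ 2,
    mul_ne_zero (zpow_ne_zero _ two_ne_zero) (pow_ne_zero _ hL0), ?_, ?_⟩
  · rw [← (leadingLCoeff_eq_deriv_of_analyticRank_eq_one hr1).1,
      leadingLCoeff_congruentNumberCurve_eq_of_isScriptL (Nat.pos_of_ne_zero hN.ne_zero) hr1 hL]
    push_cast
    ring
  · rw [padicValRat_two_zpow_mul_sq hLodd, he]

/-- **C-P2-1, OBSERVABLE FORM (`ord_{s=1} L(E_{2pq}, s) = 1 ∧ BSD(E_{2pq}, 2)` on all of `𝒮⁻`), from the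
datum and Monsky 1990 Cor 5.15** — through the landed equivalence of the two forms
(`congruentSilentEvenFiveBSDTwo_of_ordTwo`, door D-CN-5). The conclusion is CONDITIONAL on `hmech`
(the Monsky route's output) and on the displayed fact `h515`; nothing is asserted.
[cite: Monsky1990MockHeegner, Cor. 5.15 (2′) (p. 66)] [cite: Miller2011LMS, Def. 1.1 (arXiv:1010.2431 p. 3)] -/
theorem congruentSilentEvenFiveBSDTwo_of_oddIndexHeegnerDatum
    (h515 : cor515_rank_eq_one_and_card_selmerGroup_two)
    (hmech : ∀ p q : ℕ, p.Prime → q.Prime → p % 8 = 5 → q % 4 = 3 → jacobiSym p q = -1 →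
      OddIndexHeegnerDatum (2 * (p * q))) :
    CongruentSilentEvenFiveBSDTwo :=
  congruentSilentEvenFiveBSDTwo_of_ordTwo h515
    (congruentSilentEvenFiveOrdTwo_of_oddIndexHeegnerDatum h515 hmech)

/-- **`BSD(E_{2pq}, 2)` on the WHOLE even-five two-prime family, both symbols**, from the datum on `𝒮⁻`
(this file) and the four binders of the landed `𝒮⁺` theorem: the conjecture of
`forall_bsdp_two_congruentNumberCurve_two_mul_five_mul_of_conjecture` discharged by §2.
[cite: TianYuanZhang2017, Thm. 1.2, Thm. 3.5 and §1 (1.1)] [cite: Monsky1990MockHeegner, Cor. 5.15 (2′) (p. 66)]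
[cite: Miller2011LMS, Def. 1.1 (arXiv:1010.2431 p. 3)] -/
theorem forall_bsdp_two_congruentNumberCurve_two_mul_five_mul_of_oddIndexHeegnerDatum
    (hTYZ : tyz_genusPointData) (hGZK : rank_eq_analyticRank_of_analyticRank_le_one)
    (hR : Literature.NumberTheory.QuadraticFields.RedeiReichardt.redeiReichardt_fourTwoCard_classGroup)
    (h515 : cor515_rank_eq_one_and_card_selmerGroup_two)
    (hmech : ∀ p q : ℕ, p.Prime → q.Prime → p % 8 = 5 → q % 4 = 3 → jacobiSym p q = -1 →
      OddIndexHeegnerDatum (2 * (p * q))) :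
    ∀ p q : ℕ, p.Prime → q.Prime → p % 8 = 5 → q % 4 = 3 →
      BSDp (congruentNumberCurve (2 * (p * q))) 2 :=
  forall_bsdp_two_congruentNumberCurve_two_mul_five_mul_of_conjecture hTYZ hGZK hR h515
    (congruentSilentEvenFiveBSDTwo_of_oddIndexHeegnerDatum h515 hmech)

/-! ## §3 Bookkeeping: modulo rank one the datum IS "`𝓛(N)` odd" (so it is never an input) -/

/-- **Converse: `𝓛(N)` odd and rank one ⟹ the datum** (take `y := L·g`): with `g` a generator, `y − L·g = 0`
is torsion, two generators differ by a sign modulo torsion, and `L·g = 2z + t` would give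
`(L − 2m)·ḡ = 0` in the torsion-free quotient `E_N(ℚ)/tor` with `ḡ ≠ 0`, i.e. `L` even. Together with
§2 this shows `OddIndexHeegnerDatum N ⟺ (∃ L odd, IsScriptL N L)` modulo rank one: the datum carries
EXACTLY the crux and is NEVER to be vendored as a fact. [cite: SilvermanAEC2009, Thm. VIII.6.7] -/
theorem oddIndexHeegnerDatum_of_odd_scriptL {N : ℕ} (hN0 : N ≠ 0)
    (hrank : (congruentNumberCurve N).mordellWeilRank = 1) {L : ℤ} (hLodd : Odd L)
    (hL : IsScriptL N L) : OddIndexHeegnerDatum N := by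
  obtain ⟨g, hgen, hgtor⟩ := exists_generatesFreePartRat_of_mordellWeilRank_eq_one hN0 hrank
  have e : inst = fun a b => Classical.propDecidable (a = b) := Subsingleton.elim _ _
  subst e
  letI : DecidableEq ℚ := fun a b => Classical.propDecidable (a = b)
  -- `ḡ ≠ 0` in `E_N(ℚ)/tor`
  have hg0 : (QuotientAddGroup.mk g : mordellWeilModTorsion (congruentNumberCurve N)) ≠ 0 := by
    intro h
    exact hgtor ((AddCommGroup.mem_torsion g).mp ((QuotientAddGroup.eq_zero_iff g).mp h))
  -- the class of a point is `m • ḡ` where `z − m • g` is torsion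
  have hcls : ∀ (z g' : (congruentNumberCurve N).toAffine.Point) (m : ℤ),
      IsOfFinAddOrder (z - m • g') →
      (QuotientAddGroup.mk z : mordellWeilModTorsion (congruentNumberCurve N)) =
        m • (QuotientAddGroup.mk g' : mordellWeilModTorsion (congruentNumberCurve N)) := by
    intro z g' m hm
    have h1 : (QuotientAddGroup.mk (z - m • g') : mordellWeilModTorsion (congruentNumberCurve N)) = 0 :=
      (QuotientAddGroup.eq_zero_iff _).mpr ((AddCommGroup.mem_torsion _).mpr hm)
    rwa [QuotientAddGroup.mk_sub, QuotientAddGroup.mk_zsmul, sub_eq_zero] at h1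
  refine ⟨L • g, L, hL, ?_, ?_⟩
  · -- (GZ): two generators differ by a sign modulo torsion
    intro g' hg'
    obtain ⟨m, hm⟩ := hg' g
    obtain ⟨m', hm'⟩ := hgen g'
    have e1 := hcls g' g m' hm'
    have e2 := hcls g g' m hm
    have hmm : m * m' = 1 := by
      rw [e1, ← mul_zsmul] at e2
      have h3 : (m * m' - 1) •
          (QuotientAddGroup.mk g : mordellWeilModTorsion (congruentNumberCurve N)) = 0 := by
        rw [sub_zsmul, one_zsmul, ← e2]; abel
      rcases smul_eq_zero.mp h3 with h | h
      · linarith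
      · exact absurd h hg0
    refine ⟨m, Int.eq_one_or_neg_one_of_mul_eq_one hmm, ?_⟩
    -- `L • g − (m * L) • g' = L • (g − m • g')` is torsion
    have h4 : L • g - (m * L) • g' = L • (g - m • g') := by
      rw [zsmul_sub, mul_comm m L, mul_zsmul]
    rw [h4]
    exact hm.zsmul
  · -- (M-y): `L • g = 2 • z + t` would force `L = 2m`
    intro z t ht heq
    obtain ⟨m, hm⟩ := hgen z
    have hz := hcls z g m hm
    have hq : (L - 2 * m) •
        (QuotientAddGroup.mk g : mordellWeilModTorsion (congruentNumberCurve N)) = 0 := by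
      have h1 : (QuotientAddGroup.mk (L • g) : mordellWeilModTorsion (congruentNumberCurve N)) =
          QuotientAddGroup.mk ((2 : ℤ) • z + t) := by rw [heq]
      have ht0 : (QuotientAddGroup.mk t : mordellWeilModTorsion (congruentNumberCurve N)) = 0 :=
        (QuotientAddGroup.eq_zero_iff _).mpr ((AddCommGroup.mem_torsion _).mpr ht)
      rw [QuotientAddGroup.mk_zsmul, QuotientAddGroup.mk_add, QuotientAddGroup.mk_zsmul, ht0,
        add_zero, hz, ← mul_zsmul] at h1
      rw [sub_zsmul, h1]; abel
    rcases smul_eq_zero.mp hq with h | h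
    · exact (Int.not_even_iff_odd.mpr hLodd) ⟨m, by linarith⟩
    · exact hg0 h

end Datum

end Summit.BirchSwinnertonDyer.Rank1Residual.P2

end
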